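import Summits.HodgeConjecture.HodgeConjecture.Theorems.F0LD1ThetaAdjunctionOfClass
import HarnessLib

-- As in the lineage (★ `F0LD1ThetaTransportKit`, ★ `F0LD2MeetsOfNonOrthogonal`): statements over the theta-kernel datum elaborate to very
-- large types; elaborate sequentially.
set_option Elab.async false

/-!
# Crux `HLiu418`, letter (A₂-P♮) — THE DICTIONARY: the typed conclusion «`pr_P [Θ̃_Φ(f) ∘ ιA] ≠ 0`» of ★ `Liu2021.curveTheta_nonOrthogonal₂`
# ⟺ print's «`Θ^W(V) ≠ 0`» [Liu2021, Thm. B.4 (1)(c)] (sequel of ★ `F0LD1ThetaAdjunctionOfClass`: (T3)–(T5))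

Cell hodgecm-mathlib (D-0151), FLOOR 0; crux item `HLiu418` = stmt-HodgeConjecture-24832 (route `HCCMUnconditional`); half-A line LD1 (socket 27458
`Cruxes/HLiu418/Lines/F0_AlbCm.lean`, `stub_S1_facts` = #73, closed BY NAME through `Lines/F0_P6LD_StubS1FactsThetaRoad.lean`; its one remaining printed
input after ED. 11 is the letter (A₂-P♮) = books #184♮).  Seat LD1-p01 (g6), chair LD1-plan (g3) «HANDS v9» 2026-09-02T14:02:49Z; census
`F0/P6/LD/LD2-p02/g4/CENSUS-A2P-inhouse-road.v3.LD2-p02g4.md` §6 row ④.  THEOREMS ONLY (no `def`, no instance, no notation, no named fact, no `sorry`);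
`--supports stmt-HodgeConjecture-24832 --as helper`.  Rank-generic `N`, abstract transport `ιA` (continuous, rational ↦ rational) as in ★ `F0LD1ThetaTransportKit` §1.
NO invariance of `μW` is used.

INPUT (★ `F0LD1ThetaAdjunctionOfClass`): (T1) `⟪w, [Θ̃_Φ(f) ∘ ιA]⟫_{L²(μA)} = ∫_{[U(⟨a⟩)]} Θᵗ_Φ(w̄)(q) · f(q) dμW(q)` for every `L²`-class `w` on `[U(H)]`,
with the OPPOSITE lift `Θᵗ_Φ(w̄)(q) := ∫_{[U(H)]} conj(w α) κ_q(α) dμA(α)`, `κ_q [x] = θ_Φ([ιA x], q)`; (T2) `q ↦ Θᵗ_Φ(w̄)(q)` is continuous.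
PRINT: [Liu2021, App. B §B.1 p. 97 L10–18] «`Θ^W_{μ,V}(V)` is spanned by functions `h ↦ ∫_{G(F)\G(𝔸_F)} θ_μ(g, h) f(g) dg` … for `f ∈ V`» (`V ⊆ L²_cusp(G)`),
[Thm. B.4 (1)(c) p. 98] «`Θ^W_{(μ,ν),V}(V_π) ≠ 0` for some skew-hermitian space `W` of dimension `n + 1 − 2s₀`», and [proof of Prop. D.4 (1), p. 130 last
lines] «denote `V̄_π` its complex conjugate» (Liu passes to the conjugate realisation).  TYPED ((A₂-P♮), ★ p851626 :73–:163): «`∃ a′ hρ μW f Φ hθ`,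
`P.space.toSubmodule.starProjection (MemLp.toLp [x ↦ Θ̃_Φ(f)(ιA x)] hθ) ≠ 0`».

* **(T3)** `exists_starProjection_toLp_lineThetaLift_ne_zero_of_mem` (print (c) ⟹ typed): `w ∈ P`, `Θᵗ_Φ(w̄)` not `μW`-a.e. zero ⟹ for the weight
  `f := conj ∘ Θᵗ_Φ(w̄)`, `⟪w, [Θ̃_Φ(f) ∘ ιA]⟫ = ∫ |Θᵗ_Φ(w̄)|² dμW ≠ 0`, hence `pr_P [Θ̃_Φ(f) ∘ ιA] ≠ 0` (Mathlib `Submodule.starProjection_apply_eq_zero_iff`);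
  pointwise variant `…_of_apply_ne_zero` for an open-positive `μW` (e.g. the Haar probability of the compact group `[U(⟨a⟩)]`).
* **(T4)** `exists_mem_oppositeLift_not_ae_zero_of_starProjection_ne_zero` (typed ⟹ print (c)): `pr_P v ≠ 0` for `v := [Θ̃_Φ(f) ∘ ιA]` ⟹ `w := pr_P v ∈ P`
  has `∫ Θᵗ_Φ(w̄) f dμW = ⟪pr_P v, v⟫ = ‖pr_P v‖² ≠ 0` (`v − pr_P v ⟂ P`), so `Θᵗ_Φ(w̄)` is not a.e. zero.
* **(T5)** `exists_starProjection_ne_zero_iff`: for a fixed line datum `(a, hρ, μW, Φ)` and transport `ιA`,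
  `(∃ f, pr_P [Θ̃_Φ(f) ∘ ιA] ≠ 0) ⟺ (∃ w ∈ P, Θᵗ_Φ(w̄) ≢ 0 μW-a.e.)` — the typed conclusion of (A₂-P♮) ⟺ print's (c) for the realisation `V = P̄`.

HONEST SCOPE.  Nothing printed is discharged ((a)⇒(c) of [Thm. B.4 (1)] stays PRINTED, census v3); the dictionary certifies that the typed conclusion is
EQUIVALENT to print's (c) and lets the printed row be re-typed to B.4 (1)(c)'s own sentence (the projection form becoming glue).  HC_CM is proved only
modulo the 7 printed citations (2 remaining: hLiu418 = stmt-HodgeConjecture-24832, h413 = stmt-HodgeConjecture-24833) until rung 0 closes; count-neutral.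

## References
* [Liu2021] Y. Liu, Camb. J. Math. 9 (2021) = arXiv:2102.11518: App. B §B.1 (p. 97 L10–18), Thm. B.4 (1) (p. 98 L8–21), App. D proof of Prop. D.4 (1)
  (p. 130 L(−2) – p. 131 L26).
* [FleigEtAl2018] P. Fleig, H. Gustafsson, A. Kleinschmidt, D. Persson, CUP (2018), §12.3 Def. 12.5 (12.37)–(12.38) p. 296.
* [BorelJacquet1979] A. Borel, H. Jacquet, PSPM 33.1 (1979), §4.6.
-/

set_option autoImplicit false
-- the mandated namespace has the single-problem summit's repeated segment (`HodgeConjecture.HodgeConjecture`)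
set_option linter.dupNamespace false

noncomputable section

open NumberField MeasureTheory IsDedekindDomain
open scoped Matrix ComplexOrder ENNReal InnerProductSpace ComplexConjugate
open Literature.NumberTheory.Automorphic Literature.NumberTheory.Automorphic.UnitaryGroup
open Literature.NumberTheory.Automorphic.UnitaryGroup.CotangentForms
open Literature.NumberTheory.Automorphic.IdeleClassGroup
open Literature.NumberTheory.Automorphic.Liu2021
open Literature.NumberTheory.Automorphic.Liu2021.Def411WeilCarriers
open Literature.NumberTheory.Automorphic.Liu2021.Def411WeilCarriersDoubling
open Literature.NumberTheory.GelbartRogawski1991 Literature.NumberTheory.GelbartRogawski1991.UnitaryDualPair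
open Literature.NumberTheory.Weil1964
open Literature.RepresentationTheory.Liu2021
open Literature.MeasureTheory.Integral

namespace Summit.HodgeConjecture.HodgeConjecture.Cruxes.HLiu418.F0LD1ThetaAdjunctionDictionary

open _root_.MeasureTheory
open Summit.HodgeConjecture.HodgeConjecture.Cruxes.HLiu418.F0LD1ThetaTransportKit
open Summit.HodgeConjecture.HodgeConjecture.Cruxes.HLiu418.F0LD1ThetaAdjunctionOfClass

/-! ## §2 (T3)–(T5): print's (c) versus the typed conclusion of (A₂-P♮) -/

section Dictionary

variable (L : Type) [Field L] [NumberField L] [IsCMField L] (N : ℕ) (H : Matrix (Fin N) (Fin N) L)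
  {n' : ℕ} (e₁ : Fin N × Fin 1 ≃ Fin n') (dV : Fin N → L) (hdV : ∀ i, IsCMField.complexConj L (dV i) = dV i)
  (hdV0 : ∀ i, dV i ≠ 0)
  (ιA : (adelicGroupData (↥(maximalRealSubfield L)) L (IsCMField.complexConj L) N H).Adelic →* ↥(UnitaryGroup.adelic (↥(maximalRealSubfield L)) L (IsCMField.complexConj L) N (Matrix.diagonal dV)))
  (hιA : Continuous ιA ∧ ∀ ⦃γ : (adelicGroupData (↥(maximalRealSubfield L)) L (IsCMField.complexConj L) N H).Adelic⦄,
    γ ∈ (UnitaryGroup.toAdelic (↥(maximalRealSubfield L)) L (IsCMField.complexConj L) N H).range →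
      ιA γ ∈ (UnitaryGroup.toAdelic (↥(maximalRealSubfield L)) L (IsCMField.complexConj L) N (Matrix.diagonal dV)).range)
  (μ : Literature.NumberTheory.Automorphic.IdeleClassGroup L →ₜ* Circle) (hμ : IsConjugateSymplectic L μ) (a : (↥(maximalRealSubfield L))ˣ)
  (hρ : HasThetaMajorants fun
      (p : ↥(UnitaryGroup.adelic (↥(maximalRealSubfield L)) L (IsCMField.complexConj L) N (Matrix.diagonal dV)) × ↥(UnitaryGroup.adelic (↥(maximalRealSubfield L)) L (IsCMField.complexConj L) 1 (JW (↥(maximalRealSubfield L)) L a))) (Φ : piSchwartzBruhat (↥(maximalRealSubfield L)) (Fin n')) =>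
        pairRep (↥(maximalRealSubfield L)) L (IsCMField.complexConj L) N 1 e₁ (Matrix.diagonal dV) (JW (↥(maximalRealSubfield L)) L a)
          (chiSplittingLine L e₁ dV hdV hdV0 (toHeckeCharacter L μ) (isUnitary_toHeckeCharacter L μ)
            ((isOscillatorChar_toHeckeCharacter_iff μ).mpr hμ) (TW (↥(maximalRealSubfield L)) a)
            (isUnit_det_TW (↥(maximalRealSubfield L)) a) (JW (↥(maximalRealSubfield L)) L a) (JW_eq (↥(maximalRealSubfield L)) L a))
          p Φ)
  [CompactSpace (↥(UnitaryGroup.adelic (↥(maximalRealSubfield L)) L (IsCMField.complexConj L) N (Matrix.diagonal dV)) ⧸ (UnitaryGroup.toAdelic (↥(maximalRealSubfield L)) L (IsCMField.complexConj L) N (Matrix.diagonal dV)).range)]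
  [MeasurableSpace (↥(UnitaryGroup.adelic (↥(maximalRealSubfield L)) L (IsCMField.complexConj L) 1 (JW (↥(maximalRealSubfield L)) L a)) ⧸ (UnitaryGroup.toAdelic (↥(maximalRealSubfield L)) L (IsCMField.complexConj L) 1 (JW (↥(maximalRealSubfield L)) L a)).range)]
  [BorelSpace (↥(UnitaryGroup.adelic (↥(maximalRealSubfield L)) L (IsCMField.complexConj L) 1 (JW (↥(maximalRealSubfield L)) L a)) ⧸ (UnitaryGroup.toAdelic (↥(maximalRealSubfield L)) L (IsCMField.complexConj L) 1 (JW (↥(maximalRealSubfield L)) L a)).range)]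
  (μW : Measure (↥(UnitaryGroup.adelic (↥(maximalRealSubfield L)) L (IsCMField.complexConj L) 1 (JW (↥(maximalRealSubfield L)) L a)) ⧸ (UnitaryGroup.toAdelic (↥(maximalRealSubfield L)) L (IsCMField.complexConj L) 1 (JW (↥(maximalRealSubfield L)) L a)).range))
  [IsFiniteMeasure μW]
  (Φ : piSchwartzBruhat (↥(maximalRealSubfield L)) (Fin n'))
  {μA : Measure (adelicGroupData (↥(maximalRealSubfield L)) L (IsCMField.complexConj L) N H).automorphicQuotient}
  [(adelicGroupData (↥(maximalRealSubfield L)) L (IsCMField.complexConj L) N H).IsAutomorphicMeasure μA]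
  [CompactSpace (adelicGroupData (↥(maximalRealSubfield L)) L (IsCMField.complexConj L) N H).automorphicQuotient]

include hιA


/-- **(T3) PRINT (c) ⟹ TYPED**: if an `L²`-class `w` IN the discrete automorphic representation `P` has opposite lift `Θᵗ_Φ(w̄)` NOT `μW`-a.e. zero,
then for some continuous weight `f` — namely `f := conj ∘ Θᵗ_Φ(w̄)`, for which `⟪w, [Θ̃_Φ(f) ∘ ιA]⟫ = ∫ |Θᵗ_Φ(w̄)|² dμW ≠ 0` — the projection TO `P`
of the theta class `[Θ̃_Φ(f) ∘ ιA]` is NON-ZERO (a vector orthogonal to `P` pairs to `0` with `w ∈ P`; Mathlib `Submodule.starProjection_apply_eq_zero_iff`).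
This is the passage from [Liu2021, Thm. B.4 (1)(c)] «`Θ^W(V) ≠ 0`» (for the realisation `V = P̄`) to the conclusion typed in ★ `curveTheta_nonOrthogonal₂`.
[cite: Liu2021, App. B §B.1 (p. 97 L10–18); Thm. B.4 (1)(c) (p. 98); App. D proof of Prop. D.4 (1) (p. 130–131)] [cite: FleigEtAl2018, §12.3 (12.37)–(12.38) p. 296] -/
theorem exists_starProjection_toLp_lineThetaLift_ne_zero_of_mem
    (P : DiscreteAutomorphicRep (adelicGroupData (↥(maximalRealSubfield L)) L (IsCMField.complexConj L) N H) μA)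
    {w : (adelicGroupData (↥(maximalRealSubfield L)) L (IsCMField.complexConj L) N H).L2 μA} (hw : w ∈ P.space.toSubmodule)
    (hne : ¬ (fun q => ∫ α, conj (w α) * toQuotFun (adelicGroupData (↥(maximalRealSubfield L)) L (IsCMField.complexConj L) N H)
      (fun y => (lineThetaKernelDatum L N e₁ dV hdV hdV0 μ hμ a hρ).thetaKer Φ (QuotientGroup.mk (ιA y)⁻¹, q)) α ∂μA) =ᵐ[μW] 0) :
    ∃ f : C((↥(UnitaryGroup.adelic (↥(maximalRealSubfield L)) L (IsCMField.complexConj L) 1 (JW (↥(maximalRealSubfield L)) L a)) ⧸ (UnitaryGroup.toAdelic (↥(maximalRealSubfield L)) L (IsCMField.complexConj L) 1 (JW (↥(maximalRealSubfield L)) L a)).range), ℂ),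
      P.space.toSubmodule.starProjection (MemLp.toLp _ (memLp_toQuotFun_lineThetaLift L N H e₁ dV hdV hdV0 ιA hιA μ hμ a hρ μW Φ f μA 2)) ≠ 0 := by
  haveI := compactSpace_quotient_range_toAdelic_JW L a
  -- the opposite lift as a continuous weight `F`, and `f := conj ∘ F`
  set F : C((↥(UnitaryGroup.adelic (↥(maximalRealSubfield L)) L (IsCMField.complexConj L) 1 (JW (↥(maximalRealSubfield L)) L a)) ⧸ (UnitaryGroup.toAdelic (↥(maximalRealSubfield L)) L (IsCMField.complexConj L) 1 (JW (↥(maximalRealSubfield L)) L a)).range), ℂ) :=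
    ⟨fun q => ∫ α, conj (w α) * toQuotFun (adelicGroupData (↥(maximalRealSubfield L)) L (IsCMField.complexConj L) N H)
      (fun y => (lineThetaKernelDatum L N e₁ dV hdV hdV0 μ hμ a hρ).thetaKer Φ (QuotientGroup.mk (ιA y)⁻¹, q)) α ∂μA,
      continuous_oppositeLift L N H e₁ dV hdV hdV0 ιA hιA μ hμ a hρ Φ w⟩ with hFdef
  have hFap : ∀ q, F q = ∫ α, conj (w α) * toQuotFun (adelicGroupData (↥(maximalRealSubfield L)) L (IsCMField.complexConj L) N H)
      (fun y => (lineThetaKernelDatum L N e₁ dV hdV hdV0 μ hμ a hρ).thetaKer Φ (QuotientGroup.mk (ιA y)⁻¹, q)) α ∂μA := fun q => rfl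
  refine ⟨star F, fun h0 => hne ?_⟩
  -- `pr_P v = 0` ⟹ `v ⟂ P` ⟹ `⟪w, v⟫ = 0`
  have horth := (Submodule.starProjection_apply_eq_zero_iff _).1 h0
  have hinner := Submodule.inner_right_of_mem_orthogonal hw horth
  rw [inner_toLp_lineThetaLift_eq_integral L N H e₁ dV hdV hdV0 ιA hιA μ hμ a hρ μW Φ (star F) w] at hinner
  -- `⟪w, v⟫ = ∫ F · conj F = ∫ normSq F`
  have hint : ∫ q, F q * (star F) q ∂μW = ((∫ q, Complex.normSq (F q) ∂μW : ℝ) : ℂ) := by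
    rw [← integral_complex_ofReal]
    refine integral_congr_ae (Filter.Eventually.of_forall fun q => ?_)
    dsimp only
    rw [ContinuousMap.star_apply, Complex.star_def, Complex.mul_conj]
  have hzero : ∫ q, Complex.normSq (F q) ∂μW = 0 := by
    have h1 : ∫ q, F q * (star F) q ∂μW = 0 := by
      rw [← hinner]
      refine integral_congr_ae (Filter.Eventually.of_forall fun q => ?_)
      dsimp only
      rw [hFap]
    rw [hint] at h1
    exact_mod_cast h1
  have hnn : 0 ≤ᵐ[μW] fun q => Complex.normSq (F q) := Filter.Eventually.of_forall fun q => Complex.normSq_nonneg _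
  have hintble : Integrable (fun q => Complex.normSq (F q)) μW :=
    (Complex.continuous_normSq.comp F.continuous).integrable_of_hasCompactSupport (HasCompactSupport.of_compactSpace _)
  have hae : (fun q => Complex.normSq (F q)) =ᵐ[μW] 0 := (integral_eq_zero_iff_of_nonneg_ae hnn hintble).1 hzero
  filter_upwards [hae] with q hq
  have hq' : F q = 0 := Complex.normSq_eq_zero.1 hq
  rw [hFap] at hq'
  exact hq'

/-- **(T3′) POINTWISE VARIANT**: for an OPEN-POSITIVE `μW` (e.g. the Haar probability of the compact group `[U(⟨a⟩)]`), it suffices that the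
continuous opposite lift `Θᵗ_Φ(w̄)` be non-zero at ONE point (Mathlib `Continuous.ae_eq_iff_eq`).
[cite: Liu2021, Thm. B.4 (1)(c) (p. 98)] [cite: FleigEtAl2018, §12.3 (12.37)–(12.38) p. 296] -/
theorem exists_starProjection_toLp_lineThetaLift_ne_zero_of_apply_ne_zero [μW.IsOpenPosMeasure]
    (P : DiscreteAutomorphicRep (adelicGroupData (↥(maximalRealSubfield L)) L (IsCMField.complexConj L) N H) μA)
    {w : (adelicGroupData (↥(maximalRealSubfield L)) L (IsCMField.complexConj L) N H).L2 μA} (hw : w ∈ P.space.toSubmodule)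
    (q₀ : ↥(UnitaryGroup.adelic (↥(maximalRealSubfield L)) L (IsCMField.complexConj L) 1 (JW (↥(maximalRealSubfield L)) L a)) ⧸ (UnitaryGroup.toAdelic (↥(maximalRealSubfield L)) L (IsCMField.complexConj L) 1 (JW (↥(maximalRealSubfield L)) L a)).range)
    (hq₀ : ∫ α, conj (w α) * toQuotFun (adelicGroupData (↥(maximalRealSubfield L)) L (IsCMField.complexConj L) N H)
      (fun y => (lineThetaKernelDatum L N e₁ dV hdV hdV0 μ hμ a hρ).thetaKer Φ (QuotientGroup.mk (ιA y)⁻¹, q₀)) α ∂μA ≠ 0) :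
    ∃ f : C((↥(UnitaryGroup.adelic (↥(maximalRealSubfield L)) L (IsCMField.complexConj L) 1 (JW (↥(maximalRealSubfield L)) L a)) ⧸ (UnitaryGroup.toAdelic (↥(maximalRealSubfield L)) L (IsCMField.complexConj L) 1 (JW (↥(maximalRealSubfield L)) L a)).range), ℂ),
      P.space.toSubmodule.starProjection (MemLp.toLp _ (memLp_toQuotFun_lineThetaLift L N H e₁ dV hdV hdV0 ιA hιA μ hμ a hρ μW Φ f μA 2)) ≠ 0 := by
  refine exists_starProjection_toLp_lineThetaLift_ne_zero_of_mem L N H e₁ dV hdV hdV0 ιA hιA μ hμ a hρ μW Φ P hw fun hae => hq₀ ?_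
  have hcont := continuous_oppositeLift L N H e₁ dV hdV hdV0 ιA hιA μ hμ a hρ Φ w
  have h0 := (Continuous.ae_eq_iff_eq μW hcont continuous_const).1 hae
  exact congrFun h0 q₀

/-- **(T4) TYPED ⟹ PRINT (c)**: if the projection to `P` of the theta class `v := [Θ̃_Φ(f) ∘ ιA]` is non-zero, then the class `w := pr_P v ∈ P` has
opposite lift `Θᵗ_Φ(w̄)` NOT `μW`-a.e. zero — indeed `∫ Θᵗ_Φ(w̄) f dμW = ⟪pr_P v, v⟫ = ‖pr_P v‖² ≠ 0` (by (T1), `v − pr_P v ⟂ P`).  So the typed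
conclusion of (A₂-P♮) is not STRONGER than print's (c) «`Θ^W(V) ≠ 0`» (for `V = P̄`): they are equivalent, see (T5).
[cite: Liu2021, App. B §B.1 (p. 97 L10–18); Thm. B.4 (1)(c) (p. 98)] [cite: FleigEtAl2018, §12.3 (12.37)–(12.38) p. 296] -/
theorem exists_mem_oppositeLift_not_ae_zero_of_starProjection_ne_zero
    (P : DiscreteAutomorphicRep (adelicGroupData (↥(maximalRealSubfield L)) L (IsCMField.complexConj L) N H) μA)
    (f : C((↥(UnitaryGroup.adelic (↥(maximalRealSubfield L)) L (IsCMField.complexConj L) 1 (JW (↥(maximalRealSubfield L)) L a)) ⧸ (UnitaryGroup.toAdelic (↥(maximalRealSubfield L)) L (IsCMField.complexConj L) 1 (JW (↥(maximalRealSubfield L)) L a)).range), ℂ))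
    (hpr : P.space.toSubmodule.starProjection (MemLp.toLp _ (memLp_toQuotFun_lineThetaLift L N H e₁ dV hdV hdV0 ιA hιA μ hμ a hρ μW Φ f μA 2)) ≠ 0) :
    ∃ w ∈ P.space.toSubmodule, ¬ ((fun q => ∫ α, conj (w α) * toQuotFun (adelicGroupData (↥(maximalRealSubfield L)) L (IsCMField.complexConj L) N H)
      (fun y => (lineThetaKernelDatum L N e₁ dV hdV hdV0 μ hμ a hρ).thetaKer Φ (QuotientGroup.mk (ιA y)⁻¹, q)) α ∂μA) =ᵐ[μW] 0) := by
  set v := MemLp.toLp _ (memLp_toQuotFun_lineThetaLift L N H e₁ dV hdV hdV0 ιA hιA μ hμ a hρ μW Φ f μA 2) with hv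
  refine ⟨P.space.toSubmodule.starProjection v, Submodule.starProjection_apply_mem _ v, fun hae => hpr ?_⟩
  have hinner := inner_toLp_lineThetaLift_eq_integral L N H e₁ dV hdV hdV0 ιA hιA μ hμ a hρ μW Φ f (P.space.toSubmodule.starProjection v)
  have hzero : ∫ q, (∫ α, conj ((P.space.toSubmodule.starProjection v) α) *
      toQuotFun (adelicGroupData (↥(maximalRealSubfield L)) L (IsCMField.complexConj L) N H)
        (fun y => (lineThetaKernelDatum L N e₁ dV hdV hdV0 μ hμ a hρ).thetaKer Φ (QuotientGroup.mk (ιA y)⁻¹, q)) α ∂μA) * f q ∂μW = 0 := by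
    refine integral_eq_zero_of_ae ?_
    filter_upwards [hae] with q hq
    rw [hq, Pi.zero_apply, zero_mul]
  -- `⟪pr v, v⟫ = ⟪pr v, pr v⟫`
  have hsplit : ⟪P.space.toSubmodule.starProjection v, v⟫_ℂ =
      ⟪P.space.toSubmodule.starProjection v, P.space.toSubmodule.starProjection v⟫_ℂ := by
    have h1 : v = (v - P.space.toSubmodule.starProjection v) + P.space.toSubmodule.starProjection v := (sub_add_cancel v _).symm
    calc ⟪P.space.toSubmodule.starProjection v, v⟫_ℂ
        = ⟪P.space.toSubmodule.starProjection v, (v - P.space.toSubmodule.starProjection v) + P.space.toSubmodule.starProjection v⟫_ℂ := by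
          rw [← h1]
      _ = ⟪P.space.toSubmodule.starProjection v, v - P.space.toSubmodule.starProjection v⟫_ℂ +
            ⟪P.space.toSubmodule.starProjection v, P.space.toSubmodule.starProjection v⟫_ℂ := inner_add_right _ _ _
      _ = ⟪P.space.toSubmodule.starProjection v, P.space.toSubmodule.starProjection v⟫_ℂ := by
          rw [Submodule.inner_right_of_mem_orthogonal (Submodule.starProjection_apply_mem _ v)
            (Submodule.sub_starProjection_mem_orthogonal v), zero_add]
  rw [← hv, hsplit, hzero] at hinner
  exact inner_self_eq_zero.1 hinner

/-- **(T5) THE DICTIONARY** (fixed line datum `a`, `hρ`, `μW`, `Φ` and transport `ιA`): «the projection TO `P` of SOME theta class `[Θ̃_Φ(f) ∘ ιA]`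
(`f` a continuous weight on `[U(⟨a⟩)]`) is non-zero» — the conclusion typed in ★ `Liu2021.curveTheta_nonOrthogonal₂` (A₂-P♮) — IF AND ONLY IF
«SOME `L²`-class `w ∈ P` has opposite theta lift `Θᵗ_Φ(w̄) = ∫ conj(w) θ_Φ([ιA ·], ·) dμA` not `μW`-a.e. zero» — [Liu2021, Thm. B.4 (1)(c)]'s «`Θ^W(V) ≠ 0`»
read for the complex-conjugate realisation `V = P̄` (p. 97 L10–18: `Θ^W(V)` is spanned by `h ↦ ∫ θ(g, h) f(g) dg`, `f ∈ V`; p. 130 last lines: Liu passes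
to `V̄_π`).  (T3) and (T4). [cite: Liu2021, App. B §B.1 (p. 97 L10–18); Thm. B.4 (1)(c) (p. 98); App. D proof of Prop. D.4 (1) (p. 130–131)]
[cite: FleigEtAl2018, §12.3 (12.37)–(12.38) p. 296] -/
theorem exists_starProjection_ne_zero_iff
    (P : DiscreteAutomorphicRep (adelicGroupData (↥(maximalRealSubfield L)) L (IsCMField.complexConj L) N H) μA) :
    (∃ f : C((↥(UnitaryGroup.adelic (↥(maximalRealSubfield L)) L (IsCMField.complexConj L) 1 (JW (↥(maximalRealSubfield L)) L a)) ⧸ (UnitaryGroup.toAdelic (↥(maximalRealSubfield L)) L (IsCMField.complexConj L) 1 (JW (↥(maximalRealSubfield L)) L a)).range), ℂ),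
      P.space.toSubmodule.starProjection (MemLp.toLp _ (memLp_toQuotFun_lineThetaLift L N H e₁ dV hdV hdV0 ιA hιA μ hμ a hρ μW Φ f μA 2)) ≠ 0) ↔
    ∃ w ∈ P.space.toSubmodule, ¬ ((fun q => ∫ α, conj (w α) * toQuotFun (adelicGroupData (↥(maximalRealSubfield L)) L (IsCMField.complexConj L) N H)
      (fun y => (lineThetaKernelDatum L N e₁ dV hdV hdV0 μ hμ a hρ).thetaKer Φ (QuotientGroup.mk (ιA y)⁻¹, q)) α ∂μA) =ᵐ[μW] 0) := by
  constructor
  · rintro ⟨f, hf⟩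
    exact exists_mem_oppositeLift_not_ae_zero_of_starProjection_ne_zero L N H e₁ dV hdV hdV0 ιA hιA μ hμ a hρ μW Φ P f hf
  · rintro ⟨w, hw, hne⟩
    exact exists_starProjection_toLp_lineThetaLift_ne_zero_of_mem L N H e₁ dV hdV hdV0 ιA hιA μ hμ a hρ μW Φ P hw hne

end Dictionary

end Summit.HodgeConjecture.HodgeConjecture.Cruxes.HLiu418.F0LD1ThetaAdjunctionDictionary

end
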